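import Literature.AnabelianGeometry.EtaleTheta.TemperedFrobenioidCor38SubPreStepsAutRigid
import HarnessLib

/-!
# [EtTh] Def. 3.6 (ii)(a) ⇒ the divisor monoid `Φ(A)` of a typed tempered Frobenioid is IDEMPOTENT-FREE and TORSION-FREE
# (a hand for the census of Cor. 3.8 proof row C38-L02a `PreservesPreSteps`, F-2809)

S. Mochizuki, *The étale theta function and its Frobenioid-theoretic manifestations*, Publ. RIMS **45** (2009) [EtTh],
Def. 3.6 (ii)(a), PDF p. 77 ("the submonoid `Φ^{bs-fld} := (ℝ·Φ₀^cnst)|_D ×_{(Φ^{ℝ-log})^gp} Φ` … is monoprime") and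
Def. 3.6 (i), PDF p. 76 ("the `ℝ`-vector subspace `ℝ·Φ₀^cnst ⊆ (Φ₀^ℝ)^gp`", typed as the root-closed subgroup `cnstR`)
[cite: MochizukiEtTh2009, Def 3.6 p.77]; S. Mochizuki, *The geometry of Frobenioids I* (2008) [FrdI], §0 p. 10
(monoprime monoids `≅ ℤ_{≥0}, ℚ_{≥0}, ℝ_{≥0}`: sharp and integral) and p. 11 (torsion-free monoids)
[cite: MochizukiFrdI2008, §0 p.11].

abc-iut cell, block C / F (fact-proving wave), seat abc-iut-f-128 (gen 16).  PROOF-ONLY file (0 definitions, 0 instances,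
0 notation): which "junk" the typed Def. 3.6 interface EXCLUDES from a divisor monoid `Φ(A)` — relevant to the decision on
the bare universal closure of `Cor38Hyp.PreservesPreSteps` (FACT-LIST F-2809; decision of record «undecided-as-typed»),
whose last open door (census #1–#10) is a linear image of a pre-step over a non-invertible base arrow, realisable only
with NON-INTEGRAL `Φ` (abc-iut-w6-d079 / f-128 g15: with cancellative `Φ` the image base is an FSM arrow and the
walking-arrow residual reduces to a poset question answered by `DivisibilityOrderNoBooleanFactor`).  The typed structure
`TemperedFrobenioid` does NOT make `Φ(A)` integral ("divisorial", "perf-factorial" are vocabulary clauses), but clause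
(ii)(a) still bites:

* `TemperedFrobenioid.isBaseFieldTheoreticDiv_of_of_eq_one` / `…_of_pow_of_eq_one` — an element of `Φ(A)` whose class in
  `(Φ^{ℝ-log})^gp(A)` is trivial, or merely TORSION, lies in `Φ^{bs-fld}(A)` (`ℝ·Φ₀^cnst` is a root-closed subgroup).
* **`TemperedFrobenioid.eq_one_of_mul_self_eq`** — `Φ(A)` has NO idempotent but `1` (an idempotent has trivial class, so
  it is an idempotent of the monoprime — hence cancellative — monoid `Φ^{bs-fld}(A)`).
* **`TemperedFrobenioid.isUnit_of_mul_self_dvd`** — no non-unit `t ∈ Φ(A)` is divisible by its square: `t·t ∣ t ⇒ t` is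
  a unit (if `t = t·t·w` then `t·w` is idempotent).  In particular no divisor is "self-absorbing" (`t = t·t·w`), the
  shape a level-shift of the model Frobenioid over the walking arrow would need in order to be natural with respect to
  the pure Frobenius morphisms at a FIXED zero divisor.
* **`TemperedFrobenioid.eq_one_of_pow_eq_one`**, `TemperedFrobenioid.isTorsionFree_divisorMonoid` — `Φ(A)` is
  torsion-free in the sense of [FrdI] §0 (`x ^ n = 1`, `n ≥ 1 ⇒ x = 1`): a torsion element has torsion class, lies in
  `Φ^{bs-fld}(A)` and is a unit there (abc-iut-f-128 g13's `eq_one_of_isUnit_of_isBaseFieldTheoreticDiv`); and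
  `TemperedFrobenioid.eq_one_of_pow_eq_self` (`x ^ (n+2) = x ⇒ x = 1`).

READING (cell rule R5; the FACT-LIST label of F-2809 is NOT moved by this file).  Boolean / absorbing junk (`x·x = x`,
`x·∞ = ∞`) is unavailable AS DIVISORS for every typed datum; what survives is non-integrality of the shape `x·x = x·ℓ`
with `x ≠ ℓ` (e.g. the monoid `⟨ℓ, x_k | x_k² = x_k·ℓ⟩` of the companion hand `Frobenioids/DivisibilityOrderBooleanFactor`),
whose classes are torsion-free and whose only class-trivial element is `1`.
HONEST FRAMING: bookkeeping about OUR typed Def. 3.6 interface; nothing here bears on [EtTh] Cor. 3.8 as printed or on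
[IUTchIII] Cor. 3.12; no side taken; a FACT row is an assumption label; typed ≠ proved.
-/

namespace Literature.AnabelianGeometry.EtaleTheta

open CategoryTheory Opposite Literature.AlgebraicGeometry.Frobenioids

universe u₀ v₀ u v w

variable {D₀ : Type u₀} [Category.{v₀} D₀] {V : FrdIMonoidStub.{w}}
  {T : RealifiedDivisorMonoids (D₀ := D₀) V} {D : Type u} [Category.{v} D] {VD : FrdICatStub.{u, v, w} D}

namespace TemperedFrobenioid

variable (C : TemperedFrobenioid T D VD)

/-- An element of `Φ(A)` whose class in `Φ(A)^gp` — hence in `(Φ^{ℝ-log})^gp(A)` — is trivial lies in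
`Φ^{bs-fld}(A)` (the subgroup `ℝ·Φ₀^cnst` contains `1`). [cite: MochizukiEtTh2009, Def 3.6 p.77] -/
theorem isBaseFieldTheoreticDiv_of_of_eq_one {A : Dᵒᵖ} (x : C.Φ.carrier A)
    (hx : Algebra.GrothendieckGroup.of x = 1) : C.IsBaseFieldTheoreticDiv x := by
  have key : C.ΦgpToRlog A (Algebra.GrothendieckGroup.of x) ∈ T.cnstR (C.baseOp A) := by
    rw [hx, map_one]
    exact (T.cnstR (C.baseOp A)).one_mem
  simp only [ΦgpToRlog, gpMap_of] at key
  exact ⟨x.2, key⟩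

/-- An element of `Φ(A)` whose class is TORSION lies in `Φ^{bs-fld}(A)`: `ℝ·Φ₀^cnst` is root-closed (Def. 3.6 (i),
"`ℝ`-vector subspace"). [cite: MochizukiEtTh2009, Def 3.6 p.76] -/
theorem isBaseFieldTheoreticDiv_of_pow_of_eq_one {A : Dᵒᵖ} (x : C.Φ.carrier A) {n : ℕ} (hn : n ≠ 0)
    (hx : Algebra.GrothendieckGroup.of x ^ n = 1) : C.IsBaseFieldTheoreticDiv x := by
  have key : C.ΦgpToRlog A (Algebra.GrothendieckGroup.of x) ∈ T.cnstR (C.baseOp A) := by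
    refine T.mem_cnstR_of_pow_mem (C.baseOp A) hn ?_
    rw [← map_pow, hx, map_one]
    exact (T.cnstR (C.baseOp A)).one_mem
  simp only [ΦgpToRlog, gpMap_of] at key
  exact ⟨x.2, key⟩

/-- **`Φ(A)` is idempotent-free** (Def. 3.6 (ii)(a)): `x·x = x ⇒ x = 1`.  The class of an idempotent is trivial, so
`x ∈ Φ^{bs-fld}(A)`, a monoprime — hence integral ([FrdI] §0 p. 10) — monoid, in which `x·x = x·1` forces `x = 1`.
[cite: MochizukiEtTh2009, Def 3.6 p.77] -/
theorem eq_one_of_mul_self_eq {A : Dᵒᵖ} (x : C.Φ.carrier A) (h : x * x = x) : x = 1 := by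
  have hof : Algebra.GrothendieckGroup.of x = 1 := by
    have h1 := congrArg Algebra.GrothendieckGroup.of h
    rwa [map_mul, mul_eq_left] at h1
  have hbs := C.isBaseFieldTheoreticDiv_of_of_eq_one x hof
  have hval : Subtype.val x * Subtype.val x = Subtype.val x := congrArg Subtype.val h
  haveI := (C.isMonoprime_bsFld A).isCancelMul
  have hy : (⟨Subtype.val x, hbs⟩ :
        ↥(C.Φ.carrier A ⊓ (T.cnstR (op (C.base.obj (unop A)))).toSubmonoid.comap Algebra.GrothendieckGroup.of)) *
        ⟨Subtype.val x, hbs⟩ =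
      (⟨Subtype.val x, hbs⟩ :
        ↥(C.Φ.carrier A ⊓ (T.cnstR (op (C.base.obj (unop A)))).toSubmonoid.comap Algebra.GrothendieckGroup.of)) * 1 := by
    rw [mul_one]
    exact Subtype.ext hval
  have h2 := congrArg Subtype.val (mul_left_cancel hy)
  exact Subtype.ext h2

/-- **No non-unit of `Φ(A)` is divisible by its square**: `t·t ∣ t ⇒ t` is a unit.  (If `t = t·t·w`, then `e := t·w`
satisfies `e·e = (t·t·w)·w = t·w = e`, so `e = 1` by `eq_one_of_mul_self_eq`.)  In particular `Φ(A)` contains no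
"self-absorbing" non-unit divisor `t = t·t·w`. [cite: MochizukiEtTh2009, Def 3.6 p.77] -/
theorem isUnit_of_mul_self_dvd {A : Dᵒᵖ} (t : C.Φ.carrier A) (h : t * t ∣ t) : IsUnit t := by
  obtain ⟨w, hw⟩ := h
  have he : (t * w) * (t * w) = t * w := by
    calc (t * w) * (t * w) = (t * t * w) * w := by rw [mul_mul_mul_comm, mul_assoc (t * t)]
      _ = t * w := by rw [← hw]
  exact IsUnit.of_mul_eq_one w (C.eq_one_of_mul_self_eq (t * w) he)

/-- An ABSORPTION `t·s = t` in `Φ(A)` forces the class of `s` to be trivial, hence `s ∈ Φ^{bs-fld}(A)` (so `s` is an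
element of the monoprime monoid `Φ^{bs-fld}(A) ≅ Λ_{≥0}`). [cite: MochizukiEtTh2009, Def 3.6 p.77] -/
theorem isBaseFieldTheoreticDiv_of_mul_eq_left {A : Dᵒᵖ} (t s : C.Φ.carrier A) (h : t * s = t) :
    C.IsBaseFieldTheoreticDiv s := by
  refine C.isBaseFieldTheoreticDiv_of_of_eq_one s ?_
  have h1 := congrArg Algebra.GrothendieckGroup.of h
  rwa [map_mul, mul_eq_left] at h1

/-- **`Φ(A)` is torsion-free** ([FrdI] §0 p. 11): `x ^ n = 1` with `n ≥ 1` forces `x = 1`.  The class of `x` is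
torsion, so `x ∈ Φ^{bs-fld}(A)` (root-closure of `ℝ·Φ₀^cnst`); `x` is a unit (`x · x^{n-1} = 1`), hence `x = 1` by
abc-iut-f-128 g13's `eq_one_of_isUnit_of_isBaseFieldTheoreticDiv` (monoprime ⇒ sharp). [cite: MochizukiEtTh2009, Def 3.6 p.77] -/
theorem eq_one_of_pow_eq_one {A : Dᵒᵖ} (x : C.Φ.carrier A) {n : ℕ} (hn : n ≠ 0) (h : x ^ n = 1) : x = 1 := by
  have hU : IsUnit x := IsUnit.of_pow_eq_one h hn
  refine C.eq_one_of_isUnit_of_isBaseFieldTheoreticDiv (A := unop A) x hU ?_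
  refine C.isBaseFieldTheoreticDiv_of_pow_of_eq_one x hn ?_
  rw [← map_pow, h, map_one]

/-- `Φ(A)` is torsion-free in the sense of the tree's [FrdI] §0 predicate `IsTorsionFree`. [cite: MochizukiFrdI2008, §0 p.11] -/
theorem isTorsionFree_divisorMonoid (A : Dᵒᵖ) : IsTorsionFree (C.Φ.carrier A) :=
  ⟨fun x _n hn h => C.eq_one_of_pow_eq_one x (Nat.pos_iff_ne_zero.mp hn) h⟩

/-- **No non-trivial periodic element**: `x ^ (n+2) = x ⇒ x = 1` (`x^{n+1}` is then idempotent, hence `1`, so `x` is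
torsion). [cite: MochizukiEtTh2009, Def 3.6 p.77] -/
theorem eq_one_of_pow_eq_self {A : Dᵒᵖ} (x : C.Φ.carrier A) {n : ℕ} (h : x ^ (n + 2) = x) : x = 1 := by
  have hn : n + 1 + (n + 1) = n + (n + 2) := by omega
  have he : x ^ (n + 1) * x ^ (n + 1) = x ^ (n + 1) := by
    calc x ^ (n + 1) * x ^ (n + 1) = x ^ n * x ^ (n + 2) := by rw [← pow_add, ← pow_add, hn]
      _ = x ^ n * x := by rw [h]
      _ = x ^ (n + 1) := (pow_succ x n).symm
  exact C.eq_one_of_pow_eq_one x (Nat.succ_ne_zero n) (C.eq_one_of_mul_self_eq _ he)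

/-! ### The same facts read on zero divisors of morphisms of the Frobenioid `C` -/

/-- The zero divisor of an idempotent-divisor morphism is trivial: for a morphism `φ` of `C` with `Div(φ)·Div(φ) = Div(φ)`
one has `Div(φ) = 0` (multiplicatively `1`). [cite: MochizukiEtTh2009, Def 3.6 p.77] -/
theorem div_eq_one_of_mul_self_eq {P Q : C.category} (φ : P ⟶ Q)
    (h : ModelFrobenioid.div φ * ModelFrobenioid.div φ = ModelFrobenioid.div φ) : ModelFrobenioid.div φ = 1 :=
  C.eq_one_of_mul_self_eq (ModelFrobenioid.div φ) h

/-- No morphism of `C` with NON-UNIT zero divisor `t` has `t·t ∣ t` in `Φ(Base)`. [cite: MochizukiEtTh2009, Def 3.6 p.77] -/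
theorem isUnit_div_of_mul_self_dvd {P Q : C.category} (φ : P ⟶ Q)
    (h : ModelFrobenioid.div φ * ModelFrobenioid.div φ ∣ ModelFrobenioid.div φ) : IsUnit (ModelFrobenioid.div φ) :=
  C.isUnit_of_mul_self_dvd (ModelFrobenioid.div φ) h

/-! ### v2 (append-only): `Φ(A)` is of characteristic type — units act freely -/

/-- `Φ(A)` is *of characteristic type* in the sense of the tree's [FrdI] §0 predicate `IsOfCharType`: the unit group
acts FREELY on `Φ(A)`.  (A unit `ζ` with `Z·ζ = Z` is absorbed, hence lies in `Φ^{bs-fld}(A)` by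
`isBaseFieldTheoreticDiv_of_mul_eq_left`, and is `1` there by abc-iut-f-128 g13's
`eq_one_of_isUnit_of_isBaseFieldTheoreticDiv`; the element-wise statement is abc-iut's
`TemperedFrobenioid.eq_one_of_isUnit_of_mul_eq` of `Discharge/Sec4Prop43iiHolds.lean`, not re-declared here.)
[cite: MochizukiFrdI2008, §0 p.11] -/
theorem isOfCharType_divisorMonoid (A : Dᵒᵖ) : IsOfCharType (C.Φ.carrier A) :=
  ⟨fun u a h => Units.ext (C.eq_one_of_isUnit_of_isBaseFieldTheoreticDiv (A := unop A) (u : C.Φ.carrier A) u.isUnit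
    (C.isBaseFieldTheoreticDiv_of_mul_eq_left a (u : C.Φ.carrier A) (by rw [mul_comm]; exact h)))⟩

end TemperedFrobenioid

end Literature.AnabelianGeometry.EtaleTheta
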